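import Summits.HodgeConjecture.HodgeConjecture.Theorems.SixfoldTableXCensusUnitaryGeneralRow
import Literature.AlgebraicGeometry.HodgeTheory.UnitaryHodgeGroupOfRibetTypeFourTwo
import HarnessLib

/-!
# TABLE X (dimension 6) — row 8 `g6.IV(1,1)`, the `(4,2)` HALF, ALL MEMBERS: the census nodes X2 / X1 DISCHARGED IN THE
# KERNEL on the whole isogeny class, `hU` of L13 now DISCHARGED by the tree's `(4,2)` Lie theorem (Moonen–Zarhin 1999
# (2.3)–(2.5), Table 1 row IV `(4,2)`; Ribet 1983 Thm. 0) — cell `pub-hodgeav-hg6`, req-37 (A) Q2b, eng-5 g6, lead g2 00:04:14Z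

HONEST FRAMING. HC, `HC_AV` (stmt-1333), `HC_CM` (stmt-3052) and the rung H2 are NOT proved and do not occur here. The
census nodes `TableX.SixfoldCodimTwoCensus` (X2) / `TableX.SixfoldCodimThreeCensus` (X1) of `SixfoldTableXCover` are OURS
(`@[conjecture]`), never asserted — they quantify over ALL off-residue sixfolds; here they are DISCHARGED on one isogeny
class per hypothesis set. KERNEL ONLY: theorems over existing declarations; no definition, no `sorry`, no named fact, no
displayed Lie hypothesis; typed ≠ proved.

WHY THIS MODULE (census-node self-audit, axis A7 «a row VERIFIED in the kernel, not by dossier», continued). L13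
(`SixfoldTableXCensusUnitaryGeneralRow`, eng-4 g5) put the `(4,2)` half of row 8 on A7 for the GENERAL member, with the
Lie hypothesis `hU` («every `(φ^*)_ℂ`-commuting `ψ_ℂ`-skew operator of `H¹(B(ℂ); ℂ)` lies in `Lie Hg(H¹(B)) ⊗ ℂ`», i.e.
`Hg(B) = U_k(V,ψ)`) DISPLAYED and the sentence «when the cell's U-programme lands, the `(4,2)` half joins A7 for every member
through §2 with `hU` discharged — no further port». It has landed: the complex core V5
(`UnitaryThetaCore.top_or_radical_two_four`, eng-5 g5), the socket U1d/U1c/U1b and the radical kill U1 (eng-5 g4), assembled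
in H1a `UnitaryThetaFourTwo.mem_hodgeLieC_of_commute_of_skew` (`Motives/HodgeThetaSubalgebraUnitaryFourTwo`) and read
geometrically in H1b `hodgeLieC_fourTwo_of_eigenMultiplicity` (`HodgeTheory/UnitaryHodgeGroupOfRibetTypeFourTwo`), give
`hU` for EVERY complex abelian variety `B` with `φ ≫ φ = -d` (`d > 0`), `dim_ℚ End⁰(B) = 2` and eigen-multiplicities
`{4, 2}` of `φ` at `± i√d` (so `dim B = 6`, `End⁰(B) = ℚ(√-d) = k` acting on `H^{1,0}` with multiplicities `(4,2)`).
THIS FILE is L13's §1–§2 with `hU` DISCHARGED — nothing of L13 / L11 / L10 / G1 / H1 is restated, only applied: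
* §1 `census_of_isIsogenous_fourTwo` — both census conclusions X2-at-`A`, X1-at-`A` at every `A ∼ B`;
  `hodgeConjectureFor_of_isIsogenous_fourTwo` — L6's CONCLUSION `HodgeConjectureFor` on the whole isogeny class,
  UNCONDITIONAL (L13's `hodgeConjectureFor_of_isIsogenous_unitaryGeneral` with `hU` discharged; on `B` and its powers it is
  H1b's `hodgeConjectureFor_powSucc_of_fourTwo` by name).
* §2 **`census_row8_fourTwo`** — TABLE X row 8, the `(4,2)` HALF, ALL MEMBERS, KERNEL VERDICT: `dim B = 6`, every `A ∼ B`
  is IN THE NODES' DOMAIN (`dim A = 6 ∧ ¬ 𝒞 A`, L11 `offResidueSix_of_isIsogenous_ribetTypeOne`) AND satisfies X2-at-`A` ∧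
  X1-at-`A`; `census_row8_fourTwo_self`.

READING (honest scope). «All members of MZ99 Table 1 row IV `(4,2)` with `End⁰ = k`»: the displayed `hU` of L13 is now a
theorem (V5 + U1d/U1c/U1b + U1 ⟹ H1a ⟹ H1b) — the case MZ99 attribute to Tankeev; with the `(5,1)` half (L11, Ribet
Thm. 3) the whole of row 8 `g6.IV(1,1)` with `End⁰ = k` EXACTLY is on A7 for every member, except the `(3,3)` signature
(row 9, `Hg ⊆ SU_k`, L12 / L16). Sixfolds with `k ⊊ End⁰` (rows 10–13) or CM are other rows. HC / HC_AV are NOT proved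
beyond this isogeny-class statement's own content; X2 / X1 stay `@[conjecture]` globally. No inhabitant is exhibited and none
is invented here. All declarations live in the sub-namespace `TableX.TypeIVRows` (lead g2 DEDUP RULE). Nothing here is a
corollary of `HC_CM`; typed ≠ proved.
-/

set_option linter.dupNamespace false

noncomputable section

open scoped TensorProduct
open CategoryTheory
open Literature.AlgebraicGeometry Literature.AlgebraicGeometry.Motives
open Literature.AlgebraicGeometry.Motives.AbelianVariety (IsIsogenous IsSimple)
open Literature.AlgebraicGeometry.HodgeTheory
open Literature.AlgebraicGeometry.Milne1999
open Literature.AlgebraicTopology.SingularHomology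
open Literature.Barriers.HodgeConjecture
open Summit.HodgeConjecture.HodgeConjecture.Ring2.ClassTargets
open Summit.HodgeConjecture.HodgeConjecture.Ring2.Motiv (ProdCMCell)
open Summit.HodgeConjecture.HodgeConjecture.Ring2.Atlas (IsQuarticFieldTypeIVFourfold)
open Summit.HodgeConjecture.HodgeConjecture.TableX.SimpleRows

namespace Summit.HodgeConjecture.HodgeConjecture.TableX.TypeIVRows

/-! ## §1 Ribet type `(4,2)`: both census conclusions and `HodgeConjectureFor` on the isogeny class, `hU` discharged -/

/-- **Both census conclusions X2-at-`A`, X1-at-`A` at every `A` isogenous to a complex abelian variety `B` with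
`φ ≫ φ = -d` (`d > 0`), `dim_ℚ End⁰(B) = 2` and eigen-multiplicities `{4,2}` of `φ` at `± i√d`** — L13's
`census_of_isIsogenous_unitaryGeneral` with its displayed Lie hypothesis `hU` DISCHARGED by H1b
`hodgeLieC_fourTwo_of_eigenMultiplicity` (the polarization of `H¹(B(ℂ); ℚ)` and the Betti-universe facts supplied by the
tree's `smoothProjective_hodgeStructure_isPolarizable_holds`, `exists_isReal_hodgeModel_holds`,
`hodgePQ_independent_of_hodgeModel_holds`, as in R9). HC ∕ HC_AV NOT proved; X2 ∕ X1 stay `@[conjecture]` globally.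
[cite: MoonenZarhin1999LowDim, §1 (1.8), §2 (2.3)–(2.5) and Table 1] [cite: Ribet1983, Thm. 0] [cite: vanGeemen1994HodgeAV, §2.4 and Lemma 3.7] -/
theorem census_of_isIsogenous_fourTwo {A B : AbelianVariety ℂ} (φ : B ⟶ B) {d : ℕ} (hd : 0 < d)
    (hφ : φ ≫ φ = -(d • 𝟙 B)) (hE2 : Module.finrank ℚ B.endAlgebra = 2)
    (h42 : (eigenMultiplicity B φ (Complex.I * (Real.sqrt d : ℂ)) = 4 ∧
        eigenMultiplicity B φ (-(Complex.I * (Real.sqrt d : ℂ))) = 2) ∨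
      (eigenMultiplicity B φ (Complex.I * (Real.sqrt d : ℂ)) = 2 ∧
        eigenMultiplicity B φ (-(Complex.I * (Real.sqrt d : ℂ))) = 4))
    (hAB : IsIsogenous A B) :
    (∀ c : complexBetti A.X (2 * 2), IsRationalClass c → IsOfHodgeType A.dim A.X (2 * 2) 2 2 c →
      c ∈ divisorClassesSpan A.X A.dim 2 ⊔ Submodule.span ℂ {w' : complexBetti A.X (2 * 2) |
        ∃ (C : AbelianVariety ℂ) (g : A.X ⟶ C.X) (w : complexBetti C.X (2 * 2)), C.dim < A.dim ∧
          IsRationalClass w ∧ IsOfHodgeType C.dim C.X (2 * 2) 2 2 w ∧ w' = complexBetti.map g (2 * 2) w}) ∧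
    (∀ c : complexBetti A.X (2 * 3), IsRationalClass c → IsOfHodgeType A.dim A.X (2 * 3) 3 3 c →
      c ∈ divisorClassesSpan A.X A.dim 3 ⊔ Submodule.span ℂ {w' : complexBetti A.X (2 * 3) |
          ∃ (a : complexBetti A.X (2 * 2)) (b : complexBetti A.X (2 * 1)),
            IsRationalClass a ∧ IsOfHodgeType A.dim A.X (2 * 2) 2 2 a ∧ IsRationalClass b ∧
            IsOfHodgeType A.dim A.X (2 * 1) 1 1 b ∧ w' = cupProduct (two_mul_add_two_mul 2 1) a b} ⊔
        Submodule.span ℂ {w' : complexBetti A.X (2 * 3) |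
          ∃ (C : AbelianVariety ℂ) (g : A.X ⟶ C.X) (w : complexBetti C.X (2 * 3)), C.dim < A.dim ∧
            IsRationalClass w ∧ IsOfHodgeType C.dim C.X (2 * 3) 3 3 w ∧ w' = complexBetti.map g (2 * 3) w} ⊔
        Submodule.span ℂ {w' : complexBetti A.X (2 * 3) |
          ∃ (B' : AbelianVariety ℂ) (g : A.X ⟶ B'.X) (d : ℕ) (ψ : B' ⟶ B') (w : complexBetti B'.X (2 * 3)),
            B'.dim = 6 ∧ 0 < d ∧ ψ ≫ ψ = -(d • 𝟙 B') ∧ IsRationalClass w ∧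
            IsOfHodgeType B'.dim B'.X (2 * 3) 3 3 w ∧ w ∈ weilClassesOf B' ψ 3 d ∧
            w' = complexBetti.map g (2 * 3) w}) := by
  have hHD : exists_isReal_hodgeModel := exists_isReal_hodgeModel_holds
  have hI : hodgePQ_independent_of_hodgeModel := hodgePQ_independent_of_hodgeModel_holds
  haveI : HodgeTensorFacts.{0, 0} := hodgeTensorFacts_holds.{0, 0}
  have hX : IsSmoothProjective B.dim B.X := AbelianVariety.isSmoothProjective_holds
  obtain ⟨ψ⟩ : (BettiUniverse.hodge hHD (AbelianVariety.isSmoothProjective_holds (A := B)) 1).IsPolarizable :=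
    smoothProjective_hodgeStructure_isPolarizable_holds hX (BettiUniverse.realHodgeModel hHD hX)
      (BettiUniverse.realHodgeModel_isHodgeSymmetric hHD hX) 1
  have hsum := eigenMultiplicity_add_eigenMultiplicity_neg_eq_dim B φ hd hφ
  have hB0 : 0 < B.dim := by rcases h42 with ⟨h4, h2⟩ | ⟨h2, h4⟩ <;> omega
  exact census_of_isIsogenous_unitaryGeneral φ hd hφ hE2 hB0 hHD hI ψ
    (hodgeLieC_fourTwo_of_eigenMultiplicity φ hd hφ hE2 h42 hHD hI ψ) hAB

/-- **L6's CONCLUSION on the isogeny class, UNCONDITIONAL: the Hodge conjecture holds for every complex abelian variety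
isogenous to a `B` with `φ ≫ φ = -d` (`d > 0`), `dim_ℚ End⁰(B) = 2` and eigen-multiplicities `{4,2}`** (L13's
`hodgeConjectureFor_of_isIsogenous_unitaryGeneral` with `hU` discharged by H1b; on `B` and its powers this is H1b's
`hodgeConjectureFor_powSucc_of_fourTwo` by name). None of Markman₄ / Markman₆ / R-W6 / X2 / X1 / `HC_CM` enters. HC ∕ HC_AV
NOT proved beyond this statement's own content. [cite: MoonenZarhin1999LowDim, §1 (1.7)–(1.8) and Table 1]
[cite: Ribet1983, Thm. 0] [cite: vanGeemen1994HodgeAV, §2.4 and Lemma 3.7] -/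
theorem hodgeConjectureFor_of_isIsogenous_fourTwo {A B : AbelianVariety ℂ} (φ : B ⟶ B) {d : ℕ} (hd : 0 < d)
    (hφ : φ ≫ φ = -(d • 𝟙 B)) (hE2 : Module.finrank ℚ B.endAlgebra = 2)
    (h42 : (eigenMultiplicity B φ (Complex.I * (Real.sqrt d : ℂ)) = 4 ∧
        eigenMultiplicity B φ (-(Complex.I * (Real.sqrt d : ℂ))) = 2) ∨
      (eigenMultiplicity B φ (Complex.I * (Real.sqrt d : ℂ)) = 2 ∧
        eigenMultiplicity B φ (-(Complex.I * (Real.sqrt d : ℂ))) = 4))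
    (hAB : IsIsogenous A B) : HodgeConjectureFor A.dim A.X := by
  have hHD : exists_isReal_hodgeModel := exists_isReal_hodgeModel_holds
  have hI : hodgePQ_independent_of_hodgeModel := hodgePQ_independent_of_hodgeModel_holds
  haveI : HodgeTensorFacts.{0, 0} := hodgeTensorFacts_holds.{0, 0}
  have hX : IsSmoothProjective B.dim B.X := AbelianVariety.isSmoothProjective_holds
  obtain ⟨ψ⟩ : (BettiUniverse.hodge hHD (AbelianVariety.isSmoothProjective_holds (A := B)) 1).IsPolarizable :=
    smoothProjective_hodgeStructure_isPolarizable_holds hX (BettiUniverse.realHodgeModel hHD hX)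
      (BettiUniverse.realHodgeModel_isHodgeSymmetric hHD hX) 1
  have hsum := eigenMultiplicity_add_eigenMultiplicity_neg_eq_dim B φ hd hφ
  have hB0 : 0 < B.dim := by rcases h42 with ⟨h4, h2⟩ | ⟨h2, h4⟩ <;> omega
  exact hodgeConjectureFor_of_isIsogenous_unitaryGeneral φ hd hφ hE2 hB0 hHD hI ψ
    (hodgeLieC_fourTwo_of_eigenMultiplicity φ hd hφ hE2 h42 hHD hI ψ) hAB

/-! ## §2 TABLE X row 8 `g6.IV(1,1)`, the `(4,2)` half, ALL MEMBERS: kernel verdict with domain membership -/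

/-- **TABLE X ROW 8 `g6.IV(1,1)`, THE `(4,2)` HALF, ALL MEMBERS — KERNEL VERDICT on the whole isogeny class, no displayed
hypothesis.** For a complex abelian variety `B` with `φ ∈ End(B)`, `φ ≫ φ = -d` (`d > 0`), `dim_ℚ End⁰(B) = 2` (so
`End⁰(B) = ℚ(√-d) = k`) and eigen-multiplicities `{4,2}` of `φ` at `± i√d` (so `dim B = 6` and `k` acts on `H^{1,0}(B)`
with multiplicities `(4,2)`), and for every `A` isogenous to `B`: `dim A = 6` and `A` is OFF the residue class `𝒞` — `A` is
in the domain of the census nodes (L11 `offResidueSix_of_isIsogenous_ribetTypeOne`) —, AND both census conclusions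
X2-at-`A`, X1-at-`A` hold (§1). This is L13's `census_row8_unitaryGeneral` with `hU` DISCHARGED: the `(4,2)` half of row 8
joins A7 for EVERY member with `End⁰ = k` (MZ99 Table 1 row IV `(4,2)`; the special members in MZ99's sense have
`k ⊊ End⁰` and are rows 10–13 / CM). HC ∕ HC_AV NOT proved; X2 ∕ X1 stay `@[conjecture]` globally.
[cite: MoonenZarhin1999LowDim, §1 (1.8), §2 (2.3)–(2.5) and Table 1] [cite: Ribet1983, Thm. 0 and Thm. 3]
[cite: vanGeemen1994HodgeAV, Lemma 3.7] [cite: MumfordAV1970, §19 Cor. 2 of Thm. 1 (p. 174)] [cite: Milne1999, §2 p. 54] -/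
theorem census_row8_fourTwo {A B : AbelianVariety ℂ} (φ : B ⟶ B) {d : ℕ} (hd : 0 < d)
    (hφ : φ ≫ φ = -(d • 𝟙 B)) (hE2 : Module.finrank ℚ B.endAlgebra = 2)
    (h42 : (eigenMultiplicity B φ (Complex.I * (Real.sqrt d : ℂ)) = 4 ∧
        eigenMultiplicity B φ (-(Complex.I * (Real.sqrt d : ℂ))) = 2) ∨
      (eigenMultiplicity B φ (Complex.I * (Real.sqrt d : ℂ)) = 2 ∧
        eigenMultiplicity B φ (-(Complex.I * (Real.sqrt d : ℂ))) = 4))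
    (hAB : IsIsogenous A B) :
    (A.dim = 6 ∧ ¬ (IsOfCMType A ∨ ProdCMCell IsQuarticFieldTypeIVFourfold (fun Z ↦ Z.dim = 2) A)) ∧
    (∀ c : complexBetti A.X (2 * 2), IsRationalClass c → IsOfHodgeType A.dim A.X (2 * 2) 2 2 c →
      c ∈ divisorClassesSpan A.X A.dim 2 ⊔ Submodule.span ℂ {w' : complexBetti A.X (2 * 2) |
        ∃ (C : AbelianVariety ℂ) (g : A.X ⟶ C.X) (w : complexBetti C.X (2 * 2)), C.dim < A.dim ∧
          IsRationalClass w ∧ IsOfHodgeType C.dim C.X (2 * 2) 2 2 w ∧ w' = complexBetti.map g (2 * 2) w}) ∧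
    (∀ c : complexBetti A.X (2 * 3), IsRationalClass c → IsOfHodgeType A.dim A.X (2 * 3) 3 3 c →
      c ∈ divisorClassesSpan A.X A.dim 3 ⊔ Submodule.span ℂ {w' : complexBetti A.X (2 * 3) |
          ∃ (a : complexBetti A.X (2 * 2)) (b : complexBetti A.X (2 * 1)),
            IsRationalClass a ∧ IsOfHodgeType A.dim A.X (2 * 2) 2 2 a ∧ IsRationalClass b ∧
            IsOfHodgeType A.dim A.X (2 * 1) 1 1 b ∧ w' = cupProduct (two_mul_add_two_mul 2 1) a b} ⊔
        Submodule.span ℂ {w' : complexBetti A.X (2 * 3) |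
          ∃ (C : AbelianVariety ℂ) (g : A.X ⟶ C.X) (w : complexBetti C.X (2 * 3)), C.dim < A.dim ∧
            IsRationalClass w ∧ IsOfHodgeType C.dim C.X (2 * 3) 3 3 w ∧ w' = complexBetti.map g (2 * 3) w} ⊔
        Submodule.span ℂ {w' : complexBetti A.X (2 * 3) |
          ∃ (B' : AbelianVariety ℂ) (g : A.X ⟶ B'.X) (d : ℕ) (ψ : B' ⟶ B') (w : complexBetti B'.X (2 * 3)),
            B'.dim = 6 ∧ 0 < d ∧ ψ ≫ ψ = -(d • 𝟙 B') ∧ IsRationalClass w ∧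
            IsOfHodgeType B'.dim B'.X (2 * 3) 3 3 w ∧ w ∈ weilClassesOf B' ψ 3 d ∧
            w' = complexBetti.map g (2 * 3) w}) := by
  have hsum := eigenMultiplicity_add_eigenMultiplicity_neg_eq_dim B φ hd hφ
  have hB : B.dim = 6 := by rcases h42 with ⟨h4, h2⟩ | ⟨h2, h4⟩ <;> omega
  exact ⟨offResidueSix_of_isIsogenous_ribetTypeOne hB φ hd hφ hE2 hAB, census_of_isIsogenous_fourTwo φ hd hφ hE2 h42 hAB⟩

/-- **Row 8, the `(4,2)` half, the model itself**: `B` is in the nodes' domain and satisfies X2-at-`B` ∧ X1-at-`B`, no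
displayed hypothesis (the case `A = B` of `census_row8_fourTwo`). HC ∕ HC_AV NOT proved.
[cite: MoonenZarhin1999LowDim, §1 (1.8), §2 (2.3) and Table 1] [cite: Ribet1983, Thm. 0] -/
theorem census_row8_fourTwo_self {B : AbelianVariety ℂ} (φ : B ⟶ B) {d : ℕ} (hd : 0 < d)
    (hφ : φ ≫ φ = -(d • 𝟙 B)) (hE2 : Module.finrank ℚ B.endAlgebra = 2)
    (h42 : (eigenMultiplicity B φ (Complex.I * (Real.sqrt d : ℂ)) = 4 ∧
        eigenMultiplicity B φ (-(Complex.I * (Real.sqrt d : ℂ))) = 2) ∨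
      (eigenMultiplicity B φ (Complex.I * (Real.sqrt d : ℂ)) = 2 ∧
        eigenMultiplicity B φ (-(Complex.I * (Real.sqrt d : ℂ))) = 4)) :
    (B.dim = 6 ∧ ¬ (IsOfCMType B ∨ ProdCMCell IsQuarticFieldTypeIVFourfold (fun Z ↦ Z.dim = 2) B)) ∧
    (∀ c : complexBetti B.X (2 * 2), IsRationalClass c → IsOfHodgeType B.dim B.X (2 * 2) 2 2 c →
      c ∈ divisorClassesSpan B.X B.dim 2 ⊔ Submodule.span ℂ {w' : complexBetti B.X (2 * 2) |
        ∃ (C : AbelianVariety ℂ) (g : B.X ⟶ C.X) (w : complexBetti C.X (2 * 2)), C.dim < B.dim ∧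
          IsRationalClass w ∧ IsOfHodgeType C.dim C.X (2 * 2) 2 2 w ∧ w' = complexBetti.map g (2 * 2) w}) ∧
    (∀ c : complexBetti B.X (2 * 3), IsRationalClass c → IsOfHodgeType B.dim B.X (2 * 3) 3 3 c →
      c ∈ divisorClassesSpan B.X B.dim 3 ⊔ Submodule.span ℂ {w' : complexBetti B.X (2 * 3) |
          ∃ (a : complexBetti B.X (2 * 2)) (b : complexBetti B.X (2 * 1)),
            IsRationalClass a ∧ IsOfHodgeType B.dim B.X (2 * 2) 2 2 a ∧ IsRationalClass b ∧
            IsOfHodgeType B.dim B.X (2 * 1) 1 1 b ∧ w' = cupProduct (two_mul_add_two_mul 2 1) a b} ⊔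
        Submodule.span ℂ {w' : complexBetti B.X (2 * 3) |
          ∃ (C : AbelianVariety ℂ) (g : B.X ⟶ C.X) (w : complexBetti C.X (2 * 3)), C.dim < B.dim ∧
            IsRationalClass w ∧ IsOfHodgeType C.dim C.X (2 * 3) 3 3 w ∧ w' = complexBetti.map g (2 * 3) w} ⊔
        Submodule.span ℂ {w' : complexBetti B.X (2 * 3) |
          ∃ (B' : AbelianVariety ℂ) (g : B.X ⟶ B'.X) (d : ℕ) (ψ : B' ⟶ B') (w : complexBetti B'.X (2 * 3)),
            B'.dim = 6 ∧ 0 < d ∧ ψ ≫ ψ = -(d • 𝟙 B') ∧ IsRationalClass w ∧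
            IsOfHodgeType B'.dim B'.X (2 * 3) 3 3 w ∧ w ∈ weilClassesOf B' ψ 3 d ∧
            w' = complexBetti.map g (2 * 3) w}) :=
  census_row8_fourTwo φ hd hφ hE2 h42 (IsIsogenous.refl B)

end Summit.HodgeConjecture.HodgeConjecture.TableX.TypeIVRows

end
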